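import Literature.AlgebraicGeometry.Frobenioids.PadicFieldwiseSaturatedCriterion
import Literature.AlgebraicGeometry.Frobenioids.QuasiTemperoidGaloisClosure
import Literature.AlgebraicGeometry.Frobenioids.PadicGaloisBaseRamifiedCovers
import Literature.AnabelianGeometry.SemiGraphs.CosetCategoriesBridge
import HarnessLib

/-!
# Frobenioids II, Theorem 2.4 (i), proof p. 20 ll. 9–22: the characterisation «`Φ` fieldwise saturated ⟺ (a) ∧ (b)»
# UNCONDITIONALLY, for every `p`-adic Frobenioid datum over the Galois-correspondence base `B(G_{ℚ_p})⁰ → D₀`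

Mochizuki, *The geometry of Frobenioids II*, Kyushu J. Math. **62** (2008) 401–460, §2, proof of Theorem 2.4 (i),
p. 417 (= p. 20 of the author's text) [cite: MochizukiFrdII2008, Thm 2.4 (i) p.20]:

> "We begin by observing the (easily verified) fact that `Φᵢ` is fieldwise saturated if and only if the following
> two conditions hold. (a) The inductive limit monoid `lim_→ Φᵢ(B)` … is divisible. (b) For every pull-back morphism
> `φ : B → C` of `Cᵢ` that projects to a Galois covering `φ_D : B_D → C_D` of `Dᵢ`, the injection `O^⊳(C) → O^⊳(B)`
> induced by `φ` … determines a bijection `O^⊳(C) ⥲ O^⊳(B)^{Gal(B/C)}`."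

PROOF-ONLY file (abc-iut cell, seat abc-iut-w5-d229; SUBDAG-FrdII-Thm24 row **W12-L01b**, GAP-LEDGER **G-w5d229-1**;
no definitions). `PadicFieldwiseSaturatedCriterion.lean` proves the printed equivalence
(`PadicFrd.Datum.isFieldwiseSaturated_iff_divisible_and_descent`) over an ARBITRARY base `D → D₀` RELATIVE to three
binders `hdom` (Galois closures), `hfix` (Galois theory), `hram` (covers of every ramification index) — properties of
the printed base `B^temp(Π, Π°)⁰ → B^temp(G_K, G_K°)⁰ → D₀` (§2 p. 17) which fail over arbitrary bases. They were
discharged for the Galois-correspondence functor `QuasiTemperoid.galoisPadicFields p :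
ConnectedPart (BTemp (GalFbar ℚ_[p])) ⥤ PadicFld p` (abc-iut-w5-d174 `QuasiTemperoid.galoisPadicFields_hfix`,
`exists_normal_galois_dominating`; abc-iut-w5-d156 `QuasiTemperoid.hram_galoisPadicFields`). As recorded by
abc-iut-w5-d156 (NOTE OF RECORD 2026-08-26T02:05Z), that functor cannot itself be the `base` of a `PadicFrd.Datum`:
`PadicFrd.Datum D p` takes `base : D ⥤ PadicFld.{u} p` with `u` the universe of `Ob(D)`, while
`ConnectedPart (BTemp (GalFbar ℚ_[p]))` has objects in `Type 1` and `galoisPadicFields p` lands in `PadicFld.{0} p`.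

THIS FILE re-indexes the Galois-correspondence base on the SMALL model `CosetCat (GalFbar ℚ_[p])` of `B(G_{ℚ_p})⁰`
(objects the open subgroups `U`, standing for `G_{ℚ_p}/U`; abc-iut-L5-t2 / abc-iut-L1-t4 `CosetCategories.lean`) along
the LANDED bridge `CosetCat.toConnected : CosetCat Π ⥤ ConnectedPart (BTemp Π)` (full, faithful, essentially surjective;
`CosetCategoriesBridge.lean`): the composite

  `CosetCat.toConnected (isTempered_galFbar ℚ_[p]) ⋙ QuasiTemperoid.galoisPadicFields p :
     CosetCat (GalFbar ℚ_[p]) ⥤ PadicFld.{0} p`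

(`U ↦ Spec ℚ̄_p^{Stab(x_U)}` with the `p`-adic valuation) IS a universe-correct base for `PadicFrd.Datum`, and over it:

* (private helper) the normal core of an open subgroup of a compact group is open [folklore];
* `PadicFrd.galoisCosetBase_hdom` — **`H_dom`** in EXACTLY the binder shape, with `Gal f :=` "the open subgroup of the
  SOURCE of `f` is normal in `G_{ℚ_p}`" (Galois closure = coset object of the normal core);
* `PadicFrd.galoisCosetBase_hfix` — **`H_fix`** in EXACTLY the binder shape (transfer of `galoisPadicFields_hfix` along
  the full and faithful bridge; a point-stabiliser of `G/U`, `U` normal, is `U`);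
* `PadicFrd.galoisCosetBase_hram` — **`H_ram`** in EXACTLY the binder shape (transfer of `hram_galoisPadicFields` along
  the essentially surjective bridge, `ordIntMapOfHom` being functorial);
* `PadicFrd.Datum.isFieldwiseSaturated_iff_divisible_and_descent_galoisCosetBase` — **the printed equivalence with NO
  binders** for every `p`-adic Frobenioid datum `(Φ, B, Div_B)` over that base ([FrdII] Thm. 2.4 (i) proof p. 20
  ll. 9–22, case `Π = G_{ℚ_p}` of the printed base `B^temp(Π, Π°)⁰`);
* non-vacuity: `PadicFrd.Datum.isPadicLocal_galoisCosetBase` / `isMonoprime_ordInt_galoisCosetBase` (the inputs of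
  `PadicFrd.Datum.zero` over that base — the `p`-adic Frobenioid `C₀|_{B(G_{ℚ_p})⁰}` of Ex. 1.1 (i) is such a datum)
  and `PadicFrd.Datum.isFieldwiseSaturated_zero` (`Φ := Φ₀` is fieldwise saturated over any base).

Classical (Galois theory of `ℚ_p`, Eisenstein roots); nothing here bears on [IUTchIII] Cor. 3.12; no statement of the
paper is strengthened (the typed (b) quantifies over the endomorphisms of `G/U` over `G/V`, i.e. `Gal(B_D/C_D)`).
-/

noncomputable section

open CategoryTheory Opposite Function Topology
open Literature.AnabelianGeometry.SemiGraphs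

namespace Literature.AnabelianGeometry.SemiGraphs

namespace CosetCat

universe u

variable {G : Type u} [Group G] [TopologicalSpace G] [IsTopologicalGroup G] [CompactSpace G]

/-- **The normal core of an open subgroup of a compact topological group is open** (the subgroup has finite index,
so the core is a finite intersection of conjugates, closed of finite index). Galois closures in `B(Π)⁰`: the coset
object of the normal core dominates `Π/U`. [folklore] -/
private theorem isOpen_normalCore (S : Subgroup G) (hS : IsOpen (S : Set G)) : IsOpen (S.normalCore : Set G) := by
  haveI : Finite (G ⧸ S) := Subgroup.quotient_finite_of_isOpen S hS
  haveI : S.FiniteIndex := Subgroup.finiteIndex_of_finite_quotient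
  have hclosed : IsClosed (S.normalCore : Set G) := by
    have hset : (S.normalCore : Set G) = ⋂ b : G, (fun a : G => b * a * b⁻¹) ⁻¹' (S : Set G) := by
      ext a
      simp only [SetLike.mem_coe, Set.mem_iInter, Set.mem_preimage]
      exact Iff.rfl
    rw [hset]
    exact isClosed_iInter fun b => (Subgroup.isClosed_of_isOpen S hS).preimage (by fun_prop)
  exact Subgroup.isOpen_of_isClosed_of_finiteIndex _ hclosed

omit [IsTopologicalGroup G] [CompactSpace G] in
/-- In the coset object `Π/U` of `B^temp(Π)` (the value of the bridge `CosetCat.toConnected` at `U`), the stabiliser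
of the coset `1·U` is `U`. [cite: MochizukiFrdII2008, Ex 1.3 (i) p.11] -/
theorem stabilizerSubgroup_toConnected_one [IsTopologicalGroup G] (hG : IsTempered G) (X : CosetCat G) :
    Literature.AlgebraicGeometry.Frobenioids.QuasiTemperoid.stabilizerSubgroup ((toConnected hG).obj X).obj
      ((1 : G) : X.carrier) = X.sg.toSubgroup := by
  ext g
  rw [Literature.AlgebraicGeometry.Frobenioids.QuasiTemperoid.mem_stabilizerSubgroup_iff]
  change g • ((1 : G) : X.carrier) = ((1 : G) : X.carrier) ↔ _
  rw [smul_one_eq_one_iff]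
  rfl

omit [CompactSpace G] in
/-- Hence, for `U` NORMAL, the stabiliser of EVERY point of `Π/U` (in particular of its chosen base point) is normal —
`Π/U` is a Galois object of `B^temp(Π)⁰` in the sense used by `QuasiTemperoid.galoisPadicFields_hfix`.
[cite: MochizukiFrdII2008, Thm 2.4 (i) p.20] -/
theorem normal_stabilizerSubgroup_toConnected (hG : IsTempered G) (X : CosetCat G) (hX : X.sg.toSubgroup.Normal)
    (x : ((toConnected hG).obj X).obj.obj.V) :
    (Literature.AlgebraicGeometry.Frobenioids.QuasiTemperoid.stabilizerSubgroup ((toConnected hG).obj X).obj x).Normal := by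
  haveI : (Literature.AlgebraicGeometry.Frobenioids.QuasiTemperoid.stabilizerSubgroup ((toConnected hG).obj X).obj
      ((1 : G) : X.carrier)).Normal := by
    rw [stabilizerSubgroup_toConnected_one hG X]; exact hX
  rw [Literature.AlgebraicGeometry.Frobenioids.QuasiTemperoid.stabilizerSubgroup_eq_of_normal ((toConnected hG).obj X)
    ((1 : G) : X.carrier) x]
  infer_instance

end CosetCat

end Literature.AnabelianGeometry.SemiGraphs

namespace Literature.AlgebraicGeometry.Frobenioids

namespace PadicFrd

open QuasiTemperoid

variable (p : ℕ) [Fact p.Prime]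

/-! ### The Galois-correspondence base on the small coset category: the three binders discharged -/

/-- **`H_dom` over the base `CosetCat (G_{ℚ_p}) → D₀`** in EXACTLY the binder shape `hdom` of
`PadicFrd.Datum.isFieldwiseSaturated_iff_divisible_and_descent`, with `Gal f :=` "the open subgroup of the source of
`f` is normal": every `f₁ : G/U₁ → G/V` is dominated by `G/N → G/U₁ → G/V`, `N` the (open) normal core of `U₁` — the
Galois closure of the printed proof. [cite: MochizukiFrdII2008, Thm 2.4 (i) p.20] -/
theorem galoisCosetBase_hdom ⦃B₁ C : CosetCat (GalFbar ℚ_[p])⦄ (_f₁ : B₁ ⟶ C) :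
    ∃ (B : CosetCat (GalFbar ℚ_[p])) (_g : B ⟶ B₁), B.sg.toSubgroup.Normal := by
  haveI : IsGalois ℚ_[p] (Fbar ℚ_[p]) := {}
  let N : Subgroup (GalFbar ℚ_[p]) := B₁.sg.toSubgroup.normalCore
  have hN : IsOpen (N : Set (GalFbar ℚ_[p])) := CosetCat.isOpen_normalCore B₁.sg.toSubgroup B₁.sg.isOpen
  let B : CosetCat (GalFbar ℚ_[p]) := ⟨⟨N, hN⟩⟩
  refine ⟨B, CosetCat.homMk ((1 : GalFbar ℚ_[p]) : B₁.carrier) (fun u hu => ?_), ?_⟩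
  · rw [CosetCat.smul_one_eq_one_iff]
    exact Subgroup.normalCore_le B₁.sg.toSubgroup hu
  · change (B₁.sg.toSubgroup.normalCore).Normal
    infer_instance

/-- **`H_fix` over the base `CosetCat (G_{ℚ_p}) → D₀`** in EXACTLY the binder shape `hfix` (Galois theory): for
`f : G/U → G/V` with `U` normal, an element of `K_{G/U} = ℚ̄_p^{Stab}` fixed by the field maps of all endomorphisms of
`G/U` over `G/V` is the image of an element of `K_{G/V}`. Transfer of abc-iut-w5-d174's
`QuasiTemperoid.galoisPadicFields_hfix` along the full and faithful bridge `CosetCat.toConnected`.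
[cite: MochizukiFrdII2008, Thm 2.4 (i) p.20] -/
theorem galoisCosetBase_hfix ⦃B C : CosetCat (GalFbar ℚ_[p])⦄ (f : B ⟶ C) (hGal : B.sg.toSubgroup.Normal)
    (x : ((CosetCat.toConnected (isTempered_galFbar ℚ_[p]) ⋙ galoisPadicFields p).obj B).K)
    (hx : ∀ σ : B ⟶ B, σ ≫ f = f →
      ((CosetCat.toConnected (isTempered_galFbar ℚ_[p]) ⋙ galoisPadicFields p).map σ).alg x = x) :
    ∃ x₀ : ((CosetCat.toConnected (isTempered_galFbar ℚ_[p]) ⋙ galoisPadicFields p).obj C).K,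
      ((CosetCat.toConnected (isTempered_galFbar ℚ_[p]) ⋙ galoisPadicFields p).map f).alg x₀ = x := by
  haveI := CosetCat.toConnected_full (G := GalFbar ℚ_[p]) (isTempered_galFbar ℚ_[p])
  haveI := CosetCat.toConnected_faithful (G := GalFbar ℚ_[p]) (isTempered_galFbar ℚ_[p])
  have hN := CosetCat.normal_stabilizerSubgroup_toConnected (isTempered_galFbar ℚ_[p]) B hGal
    (basePt ((CosetCat.toConnected (isTempered_galFbar ℚ_[p])).obj B))
  exact galoisPadicFields_hfix p ((CosetCat.toConnected (isTempered_galFbar ℚ_[p])).map f) hN x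
    fun σ' hσ' => by
      obtain ⟨σ, rfl⟩ := (CosetCat.toConnected (isTempered_galFbar ℚ_[p])).map_surjective σ'
      exact hx σ ((CosetCat.toConnected (isTempered_galFbar ℚ_[p])).map_injective
        (by rw [Functor.map_comp]; exact hσ'))

/-- **`H_ram` over the base `CosetCat (G_{ℚ_p}) → D₀`** in EXACTLY the binder shape `hram`: over every `G/U` and for
every `N ≥ 1` there is a cover `G/V → G/U` along which every class of `ord(O_{K}^⊳)` becomes an `N`-th power (an `N`-th
root of a uniformizer). Transfer of abc-iut-w5-d156's `QuasiTemperoid.hram_galoisPadicFields` along the essentially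
surjective bridge (`ordIntMapOfHom` is functorial, `ordIntMapOfHom_comp`). [cite: MochizukiFrdII2008, Thm 2.4 (i) p.20] -/
theorem galoisCosetBase_hram (C : CosetCat (GalFbar ℚ_[p])) (N : ℕ) (hN : 0 < N) :
    ∃ (B : CosetCat (GalFbar ℚ_[p])) (f : B ⟶ C),
      ∀ a : OrdInt ((CosetCat.toConnected (isTempered_galFbar ℚ_[p]) ⋙ galoisPadicFields p).obj C).K,
        ∃ b : OrdInt ((CosetCat.toConnected (isTempered_galFbar ℚ_[p]) ⋙ galoisPadicFields p).obj B).K,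
          ordIntMapOfHom ((CosetCat.toConnected (isTempered_galFbar ℚ_[p]) ⋙ galoisPadicFields p).map f).alg
              ((CosetCat.toConnected (isTempered_galFbar ℚ_[p]) ⋙ galoisPadicFields p).map f).isValHom a
            = b ^ N := by
  haveI := CosetCat.toConnected_full (G := GalFbar ℚ_[p]) (isTempered_galFbar ℚ_[p])
  haveI := CosetCat.toConnected_essSurj (G := GalFbar ℚ_[p]) (isTempered_galFbar ℚ_[p])
  obtain ⟨B', f', h'⟩ := hram_galoisPadicFields p ((CosetCat.toConnected (isTempered_galFbar ℚ_[p])).obj C) N hN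
  -- `B'` is (isomorphic to) a coset object `G/V`; pull `f'` back to the coset category
  obtain ⟨f, hf⟩ := (CosetCat.toConnected (isTempered_galFbar ℚ_[p])).map_surjective
    (((CosetCat.toConnected (isTempered_galFbar ℚ_[p])).objObjPreimageIso B').hom ≫ f')
  refine ⟨(CosetCat.toConnected (isTempered_galFbar ℚ_[p])).objPreimage B', f, fun a => ?_⟩
  obtain ⟨b', hb'⟩ := h' a
  -- functoriality of `ord(O^⊳)` along the composite `G/V ≅ B' → G/U`
  have key : ∀ (g : (CosetCat.toConnected (isTempered_galFbar ℚ_[p])).obj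
        ((CosetCat.toConnected (isTempered_galFbar ℚ_[p])).objPreimage B') ⟶
        (CosetCat.toConnected (isTempered_galFbar ℚ_[p])).obj C)
      (_ : g = ((CosetCat.toConnected (isTempered_galFbar ℚ_[p])).objObjPreimageIso B').hom ≫ f')
      (a' : OrdInt ((galoisPadicFields p).obj ((CosetCat.toConnected (isTempered_galFbar ℚ_[p])).obj C)).K),
      ordIntMapOfHom ((galoisPadicFields p).map g).alg ((galoisPadicFields p).map g).isValHom a' =
        ordIntMapOfHom ((galoisPadicFields p).map
            ((CosetCat.toConnected (isTempered_galFbar ℚ_[p])).objObjPreimageIso B').hom).alg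
          ((galoisPadicFields p).map ((CosetCat.toConnected (isTempered_galFbar ℚ_[p])).objObjPreimageIso B').hom).isValHom
          (ordIntMapOfHom ((galoisPadicFields p).map f').alg ((galoisPadicFields p).map f').isValHom a') := by
    rintro g rfl a'
    rw [Functor.map_comp]
    exact DFunLike.congr_fun (ordIntMapOfHom_comp _ _ _ _ _) a'
  exact ⟨ordIntMapOfHom ((galoisPadicFields p).map
        ((CosetCat.toConnected (isTempered_galFbar ℚ_[p])).objObjPreimageIso B').hom).alg
      ((galoisPadicFields p).map ((CosetCat.toConnected (isTempered_galFbar ℚ_[p])).objObjPreimageIso B').hom).isValHom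
      b', (key _ hf a).trans (by rw [hb', map_pow]; rfl)⟩

namespace Datum

/-! ### The printed equivalence, unconditionally, over the Galois-correspondence base -/

/-- **[FrdII] Thm. 2.4 (i), proof p. 20 ll. 9–22: «`Φ` is fieldwise saturated if and only if (a) and (b) hold» —
UNCONDITIONAL for every `p`-adic Frobenioid datum `(Φ, B, Div_B)` over the Galois-correspondence base
`CosetCat (G_{ℚ_p}) → D₀`, `U ↦ Spec ℚ̄_p^{Stab}`** (the printed base `B^temp(Π, Π°)⁰ → B^temp(G_K, G_K°)⁰ → D₀` of §2
p. 17 in the case `Π = G_{ℚ_p}`, on its small model). (a) = every element of every `Φ(C)` acquires an `n`-th root in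
some `Φ(B)`, `B → C`; (b) = for `f : G/U → G/V` with `U` normal ("Galois covering"), every effective `b ∈ B(G/U)` fixed
by all `B(σ)`, `σ` over `G/V`, is `B(f) c` with `c ∈ B(G/V)` effective. [cite: MochizukiFrdII2008, Thm 2.4 (i) p.20] -/
theorem isFieldwiseSaturated_iff_divisible_and_descent_galoisCosetBase (d : Datum (CosetCat (GalFbar ℚ_[p])) p)
    (hd : d.base = CosetCat.toConnected (isTempered_galFbar ℚ_[p]) ⋙ galoisPadicFields p) :
    d.IsFieldwiseSaturated ↔
      (∀ (C : CosetCat (GalFbar ℚ_[p])) (x : d.Φ.obj (op C)) (n : ℕ), 0 < n →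
          ∃ (B : CosetCat (GalFbar ℚ_[p])) (f : B ⟶ C) (y : d.Φ.obj (op B)), y ^ n = (d.Φ.map f.op).hom x) ∧
        (∀ ⦃B C : CosetCat (GalFbar ℚ_[p])⦄ (f : B ⟶ C), B.sg.toSubgroup.Normal → ∀ b : d.B.obj (op B),
          (∃ y : d.Φ.obj (op B), Frobenioids.divB d.Φ d.B d.divB (op B) b = Algebra.GrothendieckGroup.of y) →
          (∀ σ : B ⟶ B, σ ≫ f = f → (d.B.map σ.op).hom b = b) →
          ∃ c : d.B.obj (op C),
            (∃ z : d.Φ.obj (op C), Frobenioids.divB d.Φ d.B d.divB (op C) c = Algebra.GrothendieckGroup.of z) ∧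
            (d.B.map f.op).hom c = b) := by
  obtain ⟨base, hloc, hc, he, Φ, ι, hι, hmono, B, toB0, divB, sq, cart, nz⟩ := d
  cases hd
  exact isFieldwiseSaturated_iff_divisible_and_descent _
    (fun ⦃B C : CosetCat (GalFbar ℚ_[p])⦄ (_ : B ⟶ C) => B.sg.toSubgroup.Normal)
    (galoisCosetBase_hdom p) (galoisCosetBase_hfix p) (galoisCosetBase_hram p)

/-- The forward direction as used downstream ([FrdII] Thm. 2.4 (ii), p. 20 l. −5: "`Φᵢ` fieldwise saturated ⇒ …"):
over the Galois-correspondence base, a fieldwise saturated datum has (a) a divisible `lim_→ Φ(B)` and (b) Galois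
descent of effective elements of `B`. [cite: MochizukiFrdII2008, Thm 2.4 (i) p.20] -/
theorem divisible_and_descent_of_isFieldwiseSaturated_galoisCosetBase (d : Datum (CosetCat (GalFbar ℚ_[p])) p)
    (hd : d.base = CosetCat.toConnected (isTempered_galFbar ℚ_[p]) ⋙ galoisPadicFields p)
    (hfs : d.IsFieldwiseSaturated) :
    (∀ (C : CosetCat (GalFbar ℚ_[p])) (x : d.Φ.obj (op C)) (n : ℕ), 0 < n →
        ∃ (B : CosetCat (GalFbar ℚ_[p])) (f : B ⟶ C) (y : d.Φ.obj (op B)), y ^ n = (d.Φ.map f.op).hom x) ∧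
      (∀ ⦃B C : CosetCat (GalFbar ℚ_[p])⦄ (f : B ⟶ C), B.sg.toSubgroup.Normal → ∀ b : d.B.obj (op B),
        (∃ y : d.Φ.obj (op B), Frobenioids.divB d.Φ d.B d.divB (op B) b = Algebra.GrothendieckGroup.of y) →
        (∀ σ : B ⟶ B, σ ≫ f = f → (d.B.map σ.op).hom b = b) →
        ∃ c : d.B.obj (op C),
          (∃ z : d.Φ.obj (op C), Frobenioids.divB d.Φ d.B d.divB (op C) c = Algebra.GrothendieckGroup.of z) ∧
          (d.B.map f.op).hom c = b) :=
  (isFieldwiseSaturated_iff_divisible_and_descent_galoisCosetBase p d hd).mp hfs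

/-! ### Non-vacuity: the Galois-correspondence base carries `p`-adic Frobenioid data -/

/-- Every value of the Galois-correspondence base `CosetCat (G_{ℚ_p}) → D₀` is a `p`-adic local field (the standing
hypothesis `isPadicLocal` of `PadicFrd.Datum`). [cite: MochizukiFrdII2008, Ex 1.3 (iii) pp.11-12] -/
theorem isPadicLocal_galoisCosetBase (A : CosetCat (GalFbar ℚ_[p])) :
    ((CosetCat.toConnected (isTempered_galFbar ℚ_[p]) ⋙ galoisPadicFields p).obj A).IsPadicLocal :=
  isPadicLocal_galoisPadicFields p _

/-- … hence `ord(O_K^⊳)` is monoprime at every value (the input `hmono` of `PadicFrd.Datum.zero`), so that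
`PadicFrd.Datum.zero (CosetCat.toConnected _ ⋙ galoisPadicFields p) (isPadicLocal_galoisCosetBase p)
CosetCat.isConnected CosetCat.isTotallyEpimorphic (isMonoprime_ordInt_galoisCosetBase p)` — the `p`-adic Frobenioid
`C₀` of Ex. 1.1 (i) restricted to `B(G_{ℚ_p})⁰` — is a datum to which
`isFieldwiseSaturated_iff_divisible_and_descent_galoisCosetBase` applies. [cite: MochizukiFrdII2008, Ex 1.1 (i)(ii) pp.7-8] -/
theorem isMonoprime_ordInt_galoisCosetBase (A : CosetCat (GalFbar ℚ_[p])) :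
    IsMonoprime (OrdInt ((CosetCat.toConnected (isTempered_galFbar ℚ_[p]) ⋙ galoisPadicFields p).obj A).K) := by
  obtain ⟨alg, hfin, hc⟩ := (isPadicLocal_galoisCosetBase p A).exists_finite
  letI := alg
  haveI := hfin
  exact PadicFld.isMonoprime_ordInt _ hc

universe v u in
/-- **`Φ := Φ₀|_D` is fieldwise saturated** over any base (`ord(K^×) ⊆ Φ₀(K)^gp` tautologically): the `p`-adic
Frobenioid `C₀|_D` of Ex. 1.1 (i)/(ii) is a fieldwise saturated datum. [cite: MochizukiFrdII2008, Ex 1.1 (ii) pp.8-9] -/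
theorem isFieldwiseSaturated_zero {D : Type u} [Category.{v} D] {p : ℕ} [Fact p.Prime] (base : D ⥤ PadicFld.{u} p)
    (hloc : ∀ A : D, (base.obj A).IsPadicLocal) (hc : IsConnected D) (he : IsTotallyEpimorphic D)
    (hmono : ∀ A : D, IsMonoprime (OrdInt (base.obj A).K)) :
    (Datum.zero base hloc hc he hmono).IsFieldwiseSaturated := by
  intro A
  refine Subgroup.closure_mono ?_
  rintro _ ⟨a, rfl⟩
  exact ⟨Realification.of _ a, rfl⟩

/-- **The equivalence fires**: for the fieldwise saturated datum `C₀|_{B(G_{ℚ_p})⁰}` over the Galois-correspondence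
base, (a) and (b) HOLD — in particular Galois descent of effective elements of `B₀ = K^×` along every Galois cover
`G/U → G/V` (a kernel instance of the printed characterisation, no hypotheses).
[cite: MochizukiFrdII2008, Thm 2.4 (i) p.20] -/
theorem divisible_and_descent_zero_galoisCosetBase :
    let d := Datum.zero (CosetCat.toConnected (isTempered_galFbar ℚ_[p]) ⋙ galoisPadicFields p)
      (isPadicLocal_galoisCosetBase p) CosetCat.isConnected CosetCat.isTotallyEpimorphic
      (isMonoprime_ordInt_galoisCosetBase p)
    (∀ (C : CosetCat (GalFbar ℚ_[p])) (x : d.Φ.obj (op C)) (n : ℕ), 0 < n →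
        ∃ (B : CosetCat (GalFbar ℚ_[p])) (f : B ⟶ C) (y : d.Φ.obj (op B)), y ^ n = (d.Φ.map f.op).hom x) ∧
      (∀ ⦃B C : CosetCat (GalFbar ℚ_[p])⦄ (f : B ⟶ C), B.sg.toSubgroup.Normal → ∀ b : d.B.obj (op B),
        (∃ y : d.Φ.obj (op B), Frobenioids.divB d.Φ d.B d.divB (op B) b = Algebra.GrothendieckGroup.of y) →
        (∀ σ : B ⟶ B, σ ≫ f = f → (d.B.map σ.op).hom b = b) →
        ∃ c : d.B.obj (op C),
          (∃ z : d.Φ.obj (op C), Frobenioids.divB d.Φ d.B d.divB (op C) c = Algebra.GrothendieckGroup.of z) ∧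
          (d.B.map f.op).hom c = b) :=
  divisible_and_descent_of_isFieldwiseSaturated_galoisCosetBase p _ rfl (isFieldwiseSaturated_zero _ _ _ _ _)

end Datum

end PadicFrd

end Literature.AlgebraicGeometry.Frobenioids

end
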